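import Summits.SmoothPoincare4.SmoothPoincare4.Theses.ZeroSurgeryExotic
import Literature.Topology.FourManifolds.Rasmussen
import Literature.Topology.FourManifolds.HomotopyBallSliceProofs
import Literature.Uncategorized.Crux

/-!
# `SVanishesOnPairs` follows from SPC4 and its failure is an exotic 4-sphere (negative lemmas for crux stmt-SmoothPoincare4-0368)

Crux `ZeroSurgeryExotic.ZseSVanishesOnPairs` (item `stmt-SmoothPoincare4-0368`) is, verbatim, the tree's
registered open statement `Literature.Uncategorized.SVanishesOnPairs` (on a `0`-surgery pair `(K, K')`
with `K` smoothly slice every Rasmussen invariant of `K'` vanishes).  Already in the tree: it is `¬` crux 2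
(`Literature.Uncategorized.not_crux_iff_sVanishesOnPairs`), it follows from MMSW Question 9.11
(`Literature.Uncategorized.sVanishesOnPairs_of_mmsw2023Question911Knot`, via the PROVED Manolescu–Piccirillo
Lemma 3.3 `Literature.Uncategorized.isHomotopyBallSlice_of_zeroSurgeryPair`), and it contains Rasmussen's
slice theorem (`Summit.SmoothPoincare4.ZeroSurgeryExotic.eq_zero_of_isSmoothlySlice_of_sVanishesOnPairs`).
This file adds the two facts that fix WHY THE CRUX RESISTS DISPROOF (standing disprover, cdisprove gen 1):

* `sVanishesOnPairs_of_spc4` — `SmoothPoincare4` and Rasmussen's Theorem 1 (`eq_zero_of_isSmoothlySlice`,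
  named fact) imply the crux, through `isSmoothlySlice_of_isHomotopyBallSlice_of_spc4` (contrapositive of
  the PROVED FGMW lemma); also from the body of the route's kill switch (0-surgery type determines
  sliceness), `sVanishesOnPairs_of_zeroSurgeryDeterminesSliceness`;
* `exotic_of_not_sVanishesOnPairs` / `not_spc4_of_not_sVanishesOnPairs` — given Rasmussen's Theorem 1, a
  DISPROOF of the crux exhibits a closed smooth 4-manifold homotopy equivalent but not diffeomorphic to
  `S⁴` (the witnessing `K'` is slice in a homotopy ball by MP 3.3 and not slice by Rasmussen).
No definitions; no route item is concluded positively.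
-/

noncomputable section

open scoped Manifold ContDiff
open ContinuousMap
open Literature.Topology.FourManifolds Literature.Uncategorized

namespace Summit.SmoothPoincare4.SmoothPoincare4.Theorems.ZseSVanishesOnPairs.Negative

/-- Under SPC4 every homotopy-ball-slice knot is smoothly slice (contrapositive of the FGMW lemma,
PROVED in the tree via Palais' disc theorem: `Knot.exists_exotic_of_isHomotopyBallSlice_not_isSmoothlySlice_holds`).
[cite: FreedmanGompfMorrisonWalker2010, §1] -/
theorem isSmoothlySlice_of_isHomotopyBallSlice_of_spc4 (hS : _root_.SmoothPoincare4) {K : Knot}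
    (hK : K.IsHomotopyBallSlice) : K.IsSmoothlySlice := by
  by_contra hns
  obtain ⟨M, i₁, i₂, i₃, i₄, i₅, i₆, ⟨e⟩, hE⟩ :=
    Knot.exists_exotic_of_isHomotopyBallSlice_not_isSmoothlySlice_holds ⟨K, hK, hns⟩
  obtain ⟨d⟩ := hS M i₄ i₅ e
  exact hE.false d

/-- **"The `0`-surgery type determines sliceness" and Rasmussen's Theorem 1 imply the crux** (the
hypothesis is the body of the route's kill switch `Assembly2`, item 0367, spelled out). [cite: Rasmussen2010, Thm. 1] -/
theorem sVanishesOnPairs_of_zeroSurgeryDeterminesSliceness (hR : eq_zero_of_isSmoothlySlice)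
    (hA : ∀ (K K' : Knot) (Y : Type) [TopologicalSpace Y] [ChartedSpace (EuclideanSpace ℝ (Fin 3)) Y],
      IsIntegralSurgery (𝓡 3) Y K 0 → IsIntegralSurgery (𝓡 3) Y K' 0 → K.IsSmoothlySlice →
        K'.IsSmoothlySlice) :
    SVanishesOnPairs :=
  fun K K' Y _ _ _ h1 h2 h3 h4 ↦ hR h4 (hA K K' Y h1 h2 h3)

/-- **SPC4 and Rasmussen's Theorem 1 imply the crux**: on a `0`-surgery pair with `K` slice, `K'` is
slice in a homotopy ball (MP Lemma 3.3, proved), hence slice under SPC4 (FGMW, proved), hence `s(K') = 0`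
(Rasmussen). So the crux is at least as safe as SPC4. [cite: ManolescuPiccirillo2023, §1 p. 1] -/
theorem sVanishesOnPairs_of_spc4 (hR : eq_zero_of_isSmoothlySlice) (hS : _root_.SmoothPoincare4) :
    SVanishesOnPairs :=
  sVanishesOnPairs_of_zeroSurgeryDeterminesSliceness hR fun _ _ _ _ _ h1 h2 h3 ↦
    isSmoothlySlice_of_isHomotopyBallSlice_of_spc4 hS (isHomotopyBallSlice_of_zeroSurgeryPair h1 h2 h3)

/-- **WHY THE CRUX RESISTS: a disproof is an exotic 4-sphere** (given Rasmussen's Theorem 1): a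
counterexample pair has `K` slice and `s(K') ≠ 0`, so `K'` is not slice (Rasmussen) yet slice in a
homotopy 4-ball (MP Lemma 3.3, proved), and the FGMW lemma (proved) yields a closed smooth `M ≃ₕ S⁴`
admitting no diffeomorphism to `S⁴`. [cite: FreedmanGompfMorrisonWalker2010, §1] -/
theorem exotic_of_not_sVanishesOnPairs (hR : eq_zero_of_isSmoothlySlice) (h : ¬ SVanishesOnPairs) :
    ∃ (M : Type) (_ : TopologicalSpace M) (_ : T2Space M) (_ : SecondCountableTopology M)
      (_ : ChartedSpace (EuclideanSpace ℝ (Fin 4)) M) (_ : IsManifold (𝓡 4) ∞ M) (_ : CompactSpace M),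
      Nonempty (M ≃ₕ (Metric.sphere (0 : EuclideanSpace ℝ (Fin 5)) 1)) ∧
        IsEmpty (M ≃ₘ⟮𝓡 4, 𝓡 4⟯ (Metric.sphere (0 : EuclideanSpace ℝ (Fin 5)) 1)) := by
  obtain ⟨K, K', Y, _, _, s, h1, h2, h3, h4, h5⟩ := not_not.1 (mt not_crux_iff_sVanishesOnPairs.1 h)
  exact Knot.exists_exotic_of_isHomotopyBallSlice_not_isSmoothlySlice_holds
    ⟨K', isHomotopyBallSlice_of_zeroSurgeryPair h1 h2 h3, fun h6 ↦ h5 (hR h4 h6)⟩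

/-- Hence, given Rasmussen's Theorem 1, a disproof of the crux refutes SPC4 — the crux can only be
killed by settling the summit negatively. [cite: ManolescuPiccirillo2023, §1 p. 1] -/
theorem not_spc4_of_not_sVanishesOnPairs (hR : eq_zero_of_isSmoothlySlice) (h : ¬ SVanishesOnPairs) :
    ¬ _root_.SmoothPoincare4 :=
  fun hS ↦ h (sVanishesOnPairs_of_spc4 hR hS)

end Summit.SmoothPoincare4.SmoothPoincare4.Theorems.ZseSVanishesOnPairs.Negative
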